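import Summits.ResolutionOfSingularities.ResolutionOfSingularities.Theorems.WeakOrderReduction
import Summits.ResolutionOfSingularities.ResolutionOfSingularities.Theorems.FaceFormCutClasses
import Literature.AlgebraicGeometry.Resolution.HironakaDirectrix
import Literature.AlgebraicGeometry.Resolution.HironakaTauScheme
import Literature.AlgebraicGeometry.Resolution.Blowups
import Literature.AlgebraicGeometry.Resolution.MarkedIdeals
import Mathlib.FieldTheory.IsAlgClosed.AlgebraicClosure
import HarnessLib

/-!
# VeryNearCutClasses — the located dimension-four core cut by the VERY-NEAR TEST at the tangent directions of a top point
(decomp-res node N53 «VeryNearCut», lens-2 g10; route-independent part, phase 1 of 3: objects, engine, classes,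
graded statements)

Source HOME/decomp-res-lens-2/g10/VeryNearCut.lean (sha256 323417289ddca7f6, 616 lines; lens + critic `lean check` rc 0,
0 sorry, `closes_of_engine` axioms standard), CRITIC-LEDGER row 66 (2026-08-30T09:37Z): CLEARED AS ENGINE + RE-LOCATION
NODE (ENGINE +1 = `VeryNearExit`, paper proof below re-walked line by line by the critic; MAP +1; residual and strata 0).
Parent BY NAME on the route: `MaxContactCut.RungOne` (29273, `E 2 → E 1`); it REFINES the tree's N50 `FaceFormCut`
(`Theorems/FaceFormCutClasses`, asides `MaxContactCut.FFGenericRung` 31576 / `FFSpecialRung` 31577 / `FFSpecialDeep`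
31578 / `FFSpecialCritical` 31579): every g9 notion is used BY NAME (`FaceFormCutClasses.*`), the g9 located residual
(a FACE-SPECIAL core top point) is cut AGAIN by a SECOND-ORDER special/generic dichotomy, and its special side is
stratified EXACTLY into three typed strata.  Pure-logic kernels (exact cuts, the engine at work, comparison with N50)
are in `Theorems/VeryNearCutKernels`; the route asides `MaxContactCut.VNGenericRung` / `VNSpecialRung` /
`VNSpecialDeep` / `VNSpecialPower` / `VNSpecialFin` (refining 29273 and 31577) and the by-name kernels to 29273 /
28544 / 30461 / 31576–31578 are in `Theorems/MaxContactCutVeryNearCut`.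
PROVER TARGET (cell #19, re-scoped by the critic): formalise (N)(V)(T) below = the port L `VeryNearExit` over the tree's
`IsBlowup.exists_reesChart_stalk` / `initialForms` / `invarianceSpace` apparatus; it DISCHARGES N50's `FaceFormExit`
(`VeryNearCutKernels.hasNearGenericFace_of_hasGenericFace`, threshold `max(2, n−1) ≤ max(2, n)`).

## The new parameter: the VERY-NEAR TEST pulled back to `y` (weighted order at a rational tangent direction)

Notation as in g9: `y` a top point of order `n ≥ 2` of `J` on the regular `Y`, `R = 𝒪_{Y,y}`, `k = k(y)`, `c = (c₀ = z,
c₁, …, c_d)` a regular system of parameters, `J ∋ f = zⁿ + G(c)` with `G` a form of degree `n+1` over `R`, face form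
`Φ = Ḡ(0, Y₁, …, Y_d)` on `P(Dir_y) = {Y₀ = 0} ≅ ℙ^{d-1}_k`.  NEW OBJECTS.  For a `k`-RATIONAL tangent
direction, given
by a vector `w ∈ R^{d+1}` whose residue `w̄ ∈ k^{d+1}` is non-zero:

* `𝔫_w := ({w_i c_j − w_j c_i}) + 𝔪²` — the germs whose differential vanishes on the line `k·w̄` (for `w̄ = e₁`:
  `𝔫 = (z, c₂, …, c_d) + 𝔪²`); a TRANSVERSAL is any `t ∈ 𝔪 ∖ 𝔫_w` (for `w̄ = e₁`: `t = c₁`);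
* `Q_w(λ) := Σ_{m + 2j ≥ λ} 𝔪^m · 𝔫_w^j` — the monomial valuation ideals of the weight `W′_w` (`t ↦
1`, every germ of
  `𝔫_w ↦ 2`): INTRINSIC in `(y, w̄)` (a change `t ↦ ut + 𝔫_w`, `c_i ↦ u c_i + 𝔪²` is `W′`-triangular);
* `Persists(w) :⟺ J ⊆ Q_w(2n) ∧ ∃ r ∈ R, J ⊆ Q_w(2n+1) + ((z + r·t²)ⁿ)` — the PERSISTENCE SHAPE.

VERY-NEAR TEST (the content of the engine; chart calculus, [CossartPiltant2008] proof of Prop. 4.2 (a)(b); [CJS2020] Thm 9.3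
(`IDir(R′/J′) = ⟨Y′ + L(U₁)⟩` at a very near point) and Thm 9.6 (δ-criteria for near / very near) are its published
downstairs forms; characteristic free, ANY regular local ring, every residue field).  Let `π` be the blow-up of `Y`
at the closed point `y`, `x′_w ∈ E = ℙ(T_y)` the `k`-rational
point of direction `w̄` (it lies on `P(Dir_y)` iff `w̄₀ = 0`).  Then

  (N)  `x′_w` is NEAR for `(J, n)`  ⟺  `J ⊆ Q_w(2n)`;
  (V)  `x′_w` is VERY NEAR (near and `τ(x′_w) = τ(y) = 1`, the tree's `stalkTau` = Hironaka's `k(x)`-rational `τ`,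
       `Literature…HironakaDirectrix.invarianceSpace` over the residue field)  ⟺  `Persists(w)`;
  (T)  [threshold `n`, strengthening g9 (a)] for EVERY point `x′` over `y` (closed or not, any residue field):
       `x′` near and `τ(x′) ≤ 1` ⟹ `mult_{x′} Φ ≥ n` (hence every geometric point of `{Φ = 0}` above `x′` has
       multiplicity `≥ n`).

PROOF (characteristic free; ANY regular local ring `R` — no coefficient field is used).  Choose a regular system
ADAPTED to `w`: a transversal `t` and generators `(z, u₂, …, u_d)` of `𝔫_w` modulo `𝔪²` (for `w̄ =
e₁`: `t = c₁`,
`u_i = c_i`; when `w̄₀ = 0` one may keep `z = c₀`).  Then `Q_w(λ)` is the MONOMIAL ideal of `W′`-weight `≥ λ`, and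
`gr_{W′}(R) := ⊕_λ Q_w(λ)/Q_w(λ+1) = k[Z, T, U]` (weighted polynomial ring: the monomials of weight `λ` are
`k`-independent modulo `Q_w(λ+1)` — read it in `gr_𝔪(R) = k[X]`, where the initial form of an element of `Q_w(λ+1)` is a
combination of monomials of weight `≥ λ+1`).  Chart `D₊(t)` of the blow-up of `Spec R` at `𝔪`: `z = t·w`,
`u_i = t·u′_i`, `R′ = R[w, u′]`, `R′/tR′ = k[w, u′]`; `x′_w = V(t, w, u′)` is the `k`-rational
point of direction `w̄`, with
regular system `(w, t, u′)` and `gr_{𝔪′}(R′_{x′}) = k[W, T, U′]`.  (N ⇐) `𝔪^m 𝔫_w^j R′ ⊆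
t^{m+j} 𝔪′^j`, so
`Q_w(2n)·t^{−n} ⊆ 𝔪′ⁿ`.  (N ⇒, and V) For `h ∈ Q_w(λ) ∖ Q_w(λ+1)`: `h/tⁿ ∈ 𝔪′^{λ−n}`
and its class modulo `𝔪′^{λ−n+1}`
is `ψ([h]_λ)` for the `k`-linear map `ψ : Z^bT^mU^a ↦ W^bT^{b+m+|a|−n}U′^a`, INJECTIVE on monomials; hence
`ord_{x′}(h/tⁿ) = W′(h) − n` exactly and `in(h/tⁿ) = ψ([h]_{W′(h)})`.  Since `J′_{x′} =
t^{−n}J·R′_{x′}` when `J ⊆ 𝔪ⁿ`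
(and no point over `y` is near when `J ⊄ 𝔪ⁿ`; `ord_{x′}J′ ≤ n` always, [CoP1] 4.2 (a)), (N) follows.
For (V): at the near
point `x′_w`, `τ(x′_w) = 1` iff `cl_n(J′_{x′}) ⊆ k[L]` for ONE `k`-rational linear form `L`;
`in_n(f/tⁿ) = ψ([f]_{2n}) =
Wⁿ + T·(…)`, because every monomial of `f − zⁿ = G(c) ∈ 𝔪^{n+1}` has degree `≥ n+1`, hence a
positive `T`-exponent under
`ψ`; so `L = W + βT + Σγ_iU′_i` and, reducing `Lⁿ = Wⁿ + T(…)` modulo `T`, `(W + γ·U′)ⁿ = Wⁿ` in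
the domain `k[W, U′]`,
i.e. `γ = 0`, `L = W + βT`.  Then `in_n(h/tⁿ) ∈ k·(W + βT)ⁿ = ψ(k·(Z + βT²)ⁿ)` for every `h ∈ J`
of weight `2n`, i.e.
`h ∈ R·(z + r t²)ⁿ + Q_w(2n+1)` with `r̄ = β` — ONE `r` for all of `J` —, which is `Persists(w)`;
conversely the shape gives
`cl_n(J′_{x′}) ⊆ k[W + r̄T]`, `τ ≤ 1`, and `τ ≥ 1` at a near point (`IsNear.one_le_stalkTau`).  The transversal is
immaterial (`t ↦ u·t + 𝔫_w` moves `(z + r t²)ⁿ` within its class modulo `Q_w(2n+1)`).  For (T): let `x′` over `y` be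
near, in a chart `D₊(t)`; `f/tⁿ = wⁿ + t·g′` with `g′ ≡ Ḡ(w, 1, u′) (mod tR′)`, so `w ∈
𝔪_{x′}` (g9 (a): `gr` is a
domain) and `x′ ∈ V(t, w) = P(Dir_y) ∩ D₊(t)`; `S := R′_{x′}/(t, w) = k[u′]_𝔭` (`𝔭` the prime of `x′` in
`E ∩ V(w) ≅ 𝔸^{d−1}_k`) is regular, so `(t, w, v)` with `v` lifting a regular system of `S` is a regular system of
`R′_{x′}` and `gr_{𝔪′}(R′_{x′}) = κ[T, W, V]`, `κ = k(x′)`.  Put `s := ord_{x′} g′` and `μ := ord_𝔭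
Φ_deh`, where
`Φ_deh = Ḡ(0, 1, u′)` is the image of `g′` in `S`; thus `s ≤ μ`.  As `Wⁿ` is not divisible by `T` there is no
cancellation: `n = ord(f/tⁿ) = min(n, 1 + s)`, so `s ≥ n − 1`, and `s ≥ n` already gives `μ ≥ n`.  If `s = n − 1`:
`in_n(f/tⁿ) = Wⁿ + T·q`, `q = in_{n−1}(g′) ≠ 0`; `τ(x′) ≤ 1` forces `in_n(f/tⁿ) = (W + βT +
γ·V)ⁿ`, and modulo `T`:
`(W + γ·V)ⁿ = Wⁿ` in the domain `κ[W, V]`, so `γ = 0` and `q = ((W + βT)ⁿ − Wⁿ)/T ∈ κ[W, T]`; were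
`μ = n − 1 = s`, the
image of `q` in `gr(S) = κ[V]` would be `in_μ(Φ_deh) ≠ 0`, a `V`-form of degree `n − 1 ≥ 1` —
contradiction; so `μ ≥ n`.
Finally the order does not drop under specialisation on the regular `𝔸^{d−1}_k` nor under `k ⊂ k̄` (`𝔭
⊆ 𝔪_v`), so every
geometric point of `P(Dir_y)` specialising `x′` has `mult Φ ≥ μ ≥ n`.  ∎

CONSEQUENCE (the engine `VeryNearExit`).  Call `y` NEAR-GENERIC if, for some `(c, G)` as above, there is a FINITE list
of rational directions `w_1, …, w_m` (vectors in `R^{d+1}`) with transversals `t_i` such that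
  (i) every geometric direction `v ∈ P(Dir_y)(k̄)` has `mult_v Φ < n` OR is proportional to some `w̄_i` (with a NON-ZERO
      factor), and  (ii) `¬Persists(w_i)` for every `i`.
Then EVERY near point `x′` over `y` has `τ(x′) ≥ 2` (class ≥ 2): if `x′` is near with `τ(x′) ≤ 1`,
by (T) every geometric
point of the closure of `x′` in `P(Dir_y)` has `mult Φ ≥ n`, so by (i) it is one of the finitely many RATIONAL points
`[w̄_i]`; a positive-dimensional closure has infinitely many geometric points, so `x′` is closed with a rational geometric
point, i.e. `x′ = x′_{w_i}` for some `i`; near with `τ = 1` (`one_le_stalkTau`) is very near, so `Persists(w_i)` by (V)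
(with the list's transversal `t_i`) — contradicting (ii).  The g9 class is contained: a generic face
(threshold `max(2, n−1) ≤ max(2, n)`) needs the empty list.  NEW near-generic points exist at every `(p, n)`:
`(2,2)`, `k` perfect: a reduced face cubic with rational singular points at each of which the ARTIN–SCHREIER FORM
`A := (∂Ḡ₃/∂Z)(0, Y)` (the `Z`-linear quadratic part of `f`) does not vanish (`Ψ_w = Z² + A(w̄)ZT² + bT⁴ ↦
W² + A(w̄)WT + bT²`, not a square iff `A(w̄) ≠ 0`), e.g. `z² + z u² + x³ + y³ + u⁷`; `(3,3)`: `z³ + t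
y³ + u⁴ + t⁴u`
(face `TY³ + U⁴` has the single triple point `e_t`, rational; `Ψ = Z³ + T⁴U`-image `Z′³ + V²U′`, `τ′
= 3`).  Purely
inseparable `(2,2)` points `z² + g(x,y,u)` over a perfect field are NEVER near-generic (`A = 0`, `b ∈ k²`).

## The cut (EXACT, pure logic) and the tags

* `SeqNGen n` — weak order reduction (dim ≤ 4, marking `n`) for data all of whose top points are of class ≥ 2 OR
  near-generic (closed, isolated);  `SeqNSpec n` — the same for data having a NEAR-SPECIAL core top point (neither).
  `SeqDimFour 1 n ⟺ SeqNGen n ∧ SeqNSpec n` (`seqDimFour_one_iff`).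
* `NearGenericRung := E 2 → ∀ n ≥ 1, SeqNGen n`  [DECIDED-MOD-PORT(M): `nearGenericRung_of_engine` from the engine
  `VeryNearExit` [DECIDED, proof above, port L — the chart lemma of [CoP1] Prop. 4.2 (a)(b) with the tree's
  `IsBlowup.exists_reesChart_stalk` / `initialForms` / `invarianceSpace`] + the engine-free bookkeeping port
  `OneShotPortTwo n` [COSTUME(M), = g9's `OneShotPort` with exit conclusion `τ′ ≥ 2`] + `OrderOneContact` [COSTUME(S)]].
  It CONTAINS g9's decided piece (`ffGenericRung_of_nearGenericRung : NearGenericRung → MaxContactCut.FFGenericRung`, 31576).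
* `NearSpecialRung := E 2 → ∀ n ≥ 1, SeqNSpec n`  [THE LOCATED RESIDUAL · UNDECIDED · IDEA-NEEDED ·
still cofinal on the
  bed ⇒ expected score 0 (K2)]; it is IMPLIED BY LETTER by the tree's g9 residual (`nearSpecialRung_of_ffSpecialRung :
  MaxContactCut.FFSpecialRung → NearSpecialRung`, 31577; EXACT modulo the decided piece: `ffSpecialRung_iff_nearSpecialRung`),
  and is sub-cut EXACTLY (`seqNSpec_iff`) into THREE typed strata:
  `SeqNSpecDeep n` [a near-special point with `Φ = 0`, «δ > 1 + 1/n»] ∧ `SeqNSpecPower n` [no deep one, but one with a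
  POWER FACE `Φ ⊗ k̄ = Lⁿ·M` (`L, M` linear): the bad locus `{mult ≥ n}` is the whole LINE `{L = 0}` — the bed's
  `t·y^p`-umbrellas, CP2019 Rem. 3.2; the one-term case of the critic's booked «FrobLinearFace»] ∧ `SeqNSpecFin n`
  [all near-special points have `Φ ≠ 0` with FINITE bad locus: an irrational point of multiplicity `≥ n`, or a rational
  VERY-NEAR direction `Persists(w)` — Giraud-type purely inseparable `(2,2)` points, Moh–type `(3,3)` points with
  `Ψ_w = Z³ + bT⁶`].
* `RungOne ⟺ NearGenericRung ∧ NearSpecialRung` (`rungOne_iff`);  `closes : NearGenericRung → NearSpecialRung →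
  MaxContactCut.RungOne`;  `closes_core` → 28544;  `closes_closedPointCore` → 30461 (all BY NAME).

WHY EACH PIECE IS STRICTLY WEAKER.  `SeqNGen`/`SeqNSpec`/strata are `SeqDimFour 1 n` restricted to sub-classes of data
(by letter: `seqNGen_of_seqDimFour_one`, `seqNSpec_of_seqDimFour_one`); `NearGenericRung` is DECIDED modulo typed ports;
`VeryNearExit` is a statement about ONE point blow-up.  WHY NOVEL (cell-relative, by construction): the object is the
weighted valuation ideal `Q_w` of a TANGENT DIRECTION and the coset family `(z + r t²)ⁿ + Q_w(2n+1)` — Hironaka's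
near / very-near test read UPSTAIRS as ideal membership at `y`; no other node reads the residual through it (lens-1:
alteration degree / Hessian corank; lens-3: Hauser-model forced walks and CP local control; lens-4: dynamics of point
towers (hugging germs); lens-5: `e = v_p(n)`, linear quotients; lens-6: F-purity).  It completes this lineage's
ONE-BLOW-UP analysis: modulo the finiteness/rationality proviso on the bad locus, near-generic = «no very-near point
over `y`», so what is left in `SeqNSpecFin` is exactly VERY-NEAR PERSISTENCE, typed upstairs.
[CossartPiltant2008 proof of Prop. 4.2 (a)(b), Lemma 4.3; Hironaka1970 Thm 2, 3; CossartJannsenSaito2020 §2 (directrix,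
near points); CossartPiltant2019 Rem. 3.2; Giraud1975; Moh1987]
-/

open CategoryTheory AlgebraicGeometry TopologicalSpace IsLocalRing
open Literature.AlgebraicGeometry.Resolution
open Summit.ResolutionOfSingularities.ResolutionOfSingularities.Theorems
open Summit.ResolutionOfSingularities.ResolutionOfSingularities.Theorems.WeakOrderReduction

namespace Summit.ResolutionOfSingularities.ResolutionOfSingularities.Theorems.VeryNearCutClasses

/-! ## §0  Forms and faces — the tree's `Theorems.FaceFormCutClasses` BY NAME (`MultLT`, `faceThreshold`, `killZero`,
`HasGenericFace`, `HasDeepFace`, `IsIsolatedTop`, `IsDeepFacePt`, `OrderOneContact`, …); NEW here: the threshold `max(2, n)`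
and the geometric face form -/

/-- The g10 threshold `max(2, n)` (= `n` for `n ≥ 2`): by the very-near test (T) a near point with `τ ≤ 1` has
`mult Φ ≥ n`.  DEFINITION (support). (Sources: CossartPiltant2008 proof of Prop. 4.2.) -/
def nearThreshold (n : ℕ) : ℕ := max 2 n

/-- The GEOMETRIC FACE FORM of a presentation `G`: `Ḡ(0, Y₁, …, Y_d) ⊗_k k̄`.  DEFINITION (support). -/
noncomputable def geomFace {R : Type} [CommRing R] [IsLocalRing R] {d : ℕ} (G : MvPolynomial (Fin (d + 1)) R) :
    MvPolynomial (Fin (d + 1)) (AlgebraicClosure (ResidueField R)) :=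
  MvPolynomial.map (algebraMap (ResidueField R) (AlgebraicClosure (ResidueField R)))
    (FaceFormCutClasses.killZero (MvPolynomial.map (residue R) G))

/-! ## §1  NEW: the weight ideals of a rational tangent direction and the persistence shape -/

section Direction

variable {R : Type} [CommRing R] [IsLocalRing R] {d : ℕ}

/-- **`𝔫_w`** — the germs whose differential vanishes on the rational tangent line `k·w̄` (`w ∈ R^{d+1}` a lift of the
direction): `({w_i c_j − w_j c_i}_{i,j}) + 𝔪²`.  For `w̄ = e₁`: `(c₀, c₂, …, c_d) + 𝔪²`.
DEFINITION (NEW object).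
(Sources: Hironaka1970 §1; CossartPiltant2008 proof of Prop. 4.2.) -/
def nIdeal (c w : Fin (d + 1) → R) : Ideal R :=
  Ideal.span {x | ∃ i j : Fin (d + 1), x = w i * c j - w j * c i} ⊔ maximalIdeal R ^ 2

/-- **`Q_w(λ) := Σ_{m + 2j ≥ λ} 𝔪^m 𝔫_w^j`** — the ideal of germs of weighted order `≥ λ` for the
weight `W′_w`
(a transversal parameter weighs `1`, the generators of `𝔫_w` weigh `2`).  The very-near test: the rational point `x′_w`
of the exceptional divisor of `Bl_y` is NEAR for `(J, n)` iff `J ⊆ Q_w(2n)`.  DEFINITION (NEW object). (Sources: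
Hironaka1970 §1; CossartPiltant2008 proof of Prop. 4.2 (a).) -/
def qIdeal (c w : Fin (d + 1) → R) (l : ℕ) : Ideal R :=
  ⨆ (m : ℕ) (j : ℕ) (_ : l ≤ m + 2 * j), maximalIdeal R ^ m * nIdeal c w ^ j

/-- **PERSISTENCE SHAPE `Persists c w t J n`** (with `t` a transversal of the direction): `J ⊆ Q_w(2n)` (near) and
`J ⊆ Q_w(2n+1) + ((c₀ + r t²)ⁿ)` for some `r ∈ R` (all degree-`n` initial forms at `x′_w` are multiples of
`(W + r̄T)ⁿ`): by the very-near test (V), EQUIVALENT to «`x′_w` is very near `y`» whenever `J ∋ c₀ⁿ +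
G(c)` with `G` of
degree `n+1`.  DEFINITION (NEW object). (Sources: CossartPiltant2008 proof of Prop. 4.2 (b); Hironaka1970 Thm 3.) -/
def Persists (c w : Fin (d + 1) → R) (t : R) (J : Ideal R) (n : ℕ) : Prop :=
  J ≤ qIdeal c w (2 * n) ∧ ∃ r : R, J ≤ qIdeal c w (2 * n + 1) ⊔ Ideal.span {(c 0 + r * t ^ 2) ^ n}

/-- The geometric direction `v ∈ k̄^{d+1}` IS the rational direction lifted by `w`: `w̄ ⊗ 1 = a·v` with `a ≠ 0`
(the non-vanishing of `a` is essential — with `a = 0` the zero vector would match everything).  DEFINITION (support). -/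
def Matches (w : Fin (d + 1) → R) (v : Fin (d + 1) → AlgebraicClosure (ResidueField R)) : Prop :=
  ∃ a : AlgebraicClosure (ResidueField R), a ≠ 0 ∧
    ∀ j, algebraMap (ResidueField R) (AlgebraicClosure (ResidueField R)) (residue R (w j)) = a * v j

/-- **`HasNearGenericFace c J n`** — THE DECIDED CLASS at ring level: `J ∋ c₀ⁿ + G(c)` (`G` a form of degree
`n+1`) and a
FINITE list of rational directions `w_i` with transversals `t_i ∈ 𝔪 ∖ 𝔫_{w_i}` such that (i) every geometric direction
`v` on `{Y₀ = 0}` has `mult_v Φ < max(2,n)` or matches some `w_i`, and (ii) no `w_i` persists.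
DEFINITION (NEW object). (Sources: CossartPiltant2008 proof of Prop. 4.2; Hironaka1970 Thm 2, 3.) -/
def HasNearGenericFace (c : Fin (d + 1) → R) (J : Ideal R) (n : ℕ) : Prop :=
  ∃ G : MvPolynomial (Fin (d + 1)) R, G.IsHomogeneous (n + 1) ∧ c 0 ^ n + MvPolynomial.eval c G ∈ J ∧
    ∃ (m : ℕ) (w : Fin m → Fin (d + 1) → R) (t : Fin m → R),
      (∀ i, t i ∈ maximalIdeal R ∧ t i ∉ nIdeal c (w i)) ∧
      (∀ v : Fin (d + 1) → AlgebraicClosure (ResidueField R), v ≠ 0 → v 0 = 0 →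
        FaceFormCutClasses.MultLT (geomFace G) v (nearThreshold n) ∨ ∃ i, Matches (w i) v) ∧
      (∀ i, ¬ Persists c (w i) (t i) J n)

/-- **`HasPowerFace c J n`** — the POWER-FACE stratum at ring level: `J ∋ c₀ⁿ + G(c)` whose geometric face form is a
non-zero product `Lⁿ·M` of linear forms (the locus of multiplicity `≥ n` is the whole line `{L = 0}`; one-term
Frobenius-linear faces `N^{p^e}·L` of the bed's umbrellas).  DEFINITION (NEW object). (Sources: CossartPiltant2019
Rem. 3.2.) -/
def HasPowerFace (c : Fin (d + 1) → R) (J : Ideal R) (n : ℕ) : Prop :=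
  ∃ G : MvPolynomial (Fin (d + 1)) R, G.IsHomogeneous (n + 1) ∧ c 0 ^ n + MvPolynomial.eval c G ∈ J ∧
    geomFace G ≠ 0 ∧
    ∃ L M : MvPolynomial (Fin (d + 1)) (AlgebraicClosure (ResidueField R)),
      L.IsHomogeneous 1 ∧ M.IsHomogeneous 1 ∧ geomFace G = L ^ n * M

end Direction

/-! ## §2  The engine's output predicate, the ENGINE, the bookkeeping port -/

/-- **EXIT (class-2 form) at `y` w.r.t. the generators `c` of `𝔪_y`**: for every blow-up `π : Y′ → Y` whose centre has
stalk ideal `(c) = 𝔪_y` at `y`, every NEAR point `x′` over `y` has `τ(x′) ≥ 2` (tree `IsNear`, `stalkTau` of the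
controlled transform).  DEFINITION (support, the conclusion shape of the engine). (Sources: CossartPiltant2008 proof
of Prop. 4.2.) -/
def ExitsAtTwo {Y : Scheme.{0}} (J : Y.IdealSheafData) (n : ℕ) (y : Y) {d : ℕ}
    (c : Fin (d + 1) → Y.presheaf.stalk y) : Prop :=
  ∀ (Y' : Scheme.{0}) (π : Y' ⟶ Y) (Z : Closeds Y), IsBlowup π (Scheme.IdealSheafData.vanishingIdeal Z) →
    IsLocallyNoetherian Y → IsLocallyNoetherian Y' →
    Ideal.span (Set.range c) = stalkIdeal (Scheme.IdealSheafData.vanishingIdeal Z) y →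
    ∀ x' : Y', π x' = y → ∀ _ : IsRegularLocalRing (Y'.presheaf.stalk x'),
      IsNear π (Scheme.IdealSheafData.vanishingIdeal Z) J n x' →
        2 ≤ stalkTau (controlledTransform π (Scheme.IdealSheafData.vanishingIdeal Z) J n) x' n

/-- **ENGINE `VeryNearExit`** [DECIDED · proof in the module docstring ((T) threshold `n` at every point over `y`;
finite rational bad list ⇒ a near `τ ≤ 1` point is a rational `x′_{w_i}`; (V) very near ⟺ `Persists`) ·
characteristic-free, EVERY residue field, EVERY dimension · port L over the tree's Rees-chart / `initialForms` /
`invarianceSpace` apparatus (siblings: `IsBlowup.not_isNear_of_stalkTau_eq_three`, `stalkTau_le_two_of_isNear_point`)]: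
at a point with regular local ring and a (minimal) regular system of parameters `c`, a near-generic face at order
`n ≥ 2` forces class ≥ 2 at every near point.  STATEMENT (engine). (Sources: CossartPiltant2008 proof of Prop. 4.2
(a)(b), Lemma 4.3; Hironaka1970 Thm 2, 3.) -/
def VeryNearExit : Prop :=
  ∀ (Y : Scheme.{0}) (J : Y.IdealSheafData) (n : ℕ), 2 ≤ n → ∀ (y : Y), ∀ _ : IsRegularLocalRing (Y.presheaf.stalk y),
    ∀ (d : ℕ) (c : Fin (d + 1) → Y.presheaf.stalk y), Ideal.span (Set.range c) = maximalIdeal (Y.presheaf.stalk y) →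
      (maximalIdeal (Y.presheaf.stalk y)).spanFinrank = d + 1 →
      HasNearGenericFace c (stalkIdeal J y) n → ExitsAtTwo J n y c

/-! ## §3  Pointwise classes at a top point -/

/-- **NEAR-GENERIC top point** (THE DECIDED CLASS): closed, isolated in the top locus, with a near-generic face in some
minimal regular system of parameters.  DEFINITION (NEW class). (Sources: CossartPiltant2008 proof of Prop. 4.2.) -/
def IsNearGenericPt {Y : Scheme.{0}} (I : Y.IdealSheafData) (n : ℕ) (y : Y) : Prop :=
  IsClosed ({y} : Set Y) ∧ FaceFormCutClasses.IsIsolatedTop I n y ∧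
    ∃ (d : ℕ) (c : Fin (d + 1) → Y.presheaf.stalk y),
      Ideal.span (Set.range c) = maximalIdeal (Y.presheaf.stalk y) ∧
        (maximalIdeal (Y.presheaf.stalk y)).spanFinrank = d + 1 ∧ HasNearGenericFace c (stalkIdeal I y) n

/-- **POWER-FACE point**: in some minimal regular system `I_y ∋ zⁿ + G(c)` with geometric face form `Lⁿ·M ≠ 0`.
DEFINITION (NEW class). (Sources: CossartPiltant2019 Rem. 3.2.) -/
def IsPowerFacePt {Y : Scheme.{0}} (I : Y.IdealSheafData) (n : ℕ) (y : Y) : Prop :=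
  ∃ (d : ℕ) (c : Fin (d + 1) → Y.presheaf.stalk y),
    Ideal.span (Set.range c) = maximalIdeal (Y.presheaf.stalk y) ∧
      (maximalIdeal (Y.presheaf.stalk y)).spanFinrank = d + 1 ∧ HasPowerFace c (stalkIdeal I y) n

/-- **EXIT point (class-2 form)**: closed, isolated, with the engine's output in some minimal regular system.
DEFINITION (support; hypothesis shape of the port). -/
def IsNearExitPt {Y : Scheme.{0}} (I : Y.IdealSheafData) (n : ℕ) (y : Y) : Prop :=
  IsClosed ({y} : Set Y) ∧ FaceFormCutClasses.IsIsolatedTop I n y ∧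
    ∃ (d : ℕ) (c : Fin (d + 1) → Y.presheaf.stalk y),
      Ideal.span (Set.range c) = maximalIdeal (Y.presheaf.stalk y) ∧
        (maximalIdeal (Y.presheaf.stalk y)).spanFinrank = d + 1 ∧ ExitsAtTwo I n y c

/-- **NEAR-SPECIAL core point** (THE LOCATED CLASS of this node): a top point NOT of class ≥ 2 and NOT near-generic.
DEFINITION (NEW class). -/
def IsNearSpecialPt {k : Type} [Field k] {Y : Scheme.{0}} (g : Y ⟶ Spec (.of k)) (hY : Scheme.IsRegular Y)
    (I : Y.IdealSheafData) (n : ℕ) (y : Y) : Prop :=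
  ¬ ClassGE g hY I n 2 y ∧ ¬ IsNearGenericPt I n y

/-! ## §4  The graded statements (fresh-data frame = the binders of `WeakOrderReduction.SeqDimFour`) -/

/-- **`SeqNGen n`** — weak order reduction in dimension four at marking `n` for data ALL of whose top points are of class
≥ 2 or NEAR-GENERIC.  [DECIDED-MOD-PORT relative to `SeqDimFour 2 n`: `nGenRungAt_of_engine`.]  STATEMENT SCHEMA.
(Sources: BierstoneGrigorievMilmanWlodarczyk2011 §3.1; CossartPiltant2008 Prop. 4.2.) -/
def SeqNGen (n : ℕ) : Prop :=
  ∀ p : ℕ, p.Prime → ∀ (k : Type) [Field k] [CharP k p]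
    (Y : Scheme.{0}) (g : Y ⟶ Spec (.of k)), IsSeparated g → LocallyOfFiniteType g → QuasiCompact g →
    ∀ hY : Scheme.IsRegular Y, topologicalKrullDim Y ≤ 4 →
    ∀ I : Y.IdealSheafData, (∀ y : Y, idealOrder I y ≤ ((n : ℕ) : ℕ∞)) →
      (∀ y : Y, idealOrder I y = ((n : ℕ) : ℕ∞) → ClassGE g hY I n 2 y ∨ IsNearGenericPt I n y) →
      ∃ t : CentreSeq Y, WeakResolution t (⟨I, [], n⟩ : MarkedIdeal Y)

/-- **`SeqNSpec n`** — THE LOCATED CLASS: weak order reduction in dimension four at marking `n` for data having a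
NEAR-SPECIAL core top point.  [UNDECIDED · IDEA-NEEDED.]  STATEMENT SCHEMA. (Sources:
BierstoneGrigorievMilmanWlodarczyk2011 §3.1; CossartPiltant2019 Rem. 3.2.) -/
def SeqNSpec (n : ℕ) : Prop :=
  ∀ p : ℕ, p.Prime → ∀ (k : Type) [Field k] [CharP k p]
    (Y : Scheme.{0}) (g : Y ⟶ Spec (.of k)), IsSeparated g → LocallyOfFiniteType g → QuasiCompact g →
    ∀ hY : Scheme.IsRegular Y, topologicalKrullDim Y ≤ 4 →
    ∀ I : Y.IdealSheafData, (∀ y : Y, idealOrder I y ≤ ((n : ℕ) : ℕ∞)) →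
      (∃ y : Y, idealOrder I y = ((n : ℕ) : ℕ∞) ∧ IsNearSpecialPt g hY I n y) →
      ∃ t : CentreSeq Y, WeakResolution t (⟨I, [], n⟩ : MarkedIdeal Y)

/-- `SeqNSpecDeep n` — DEEP stratum: some near-special top point is deep-faced (`Φ = 0`; bed: kangaroo / Moh /
weighted-quotient cylinders).  [UNDECIDED.] (Sources: Hironaka1970; CossartJannsenSaito2020; Moh1987.) -/
def SeqNSpecDeep (n : ℕ) : Prop :=
  ∀ p : ℕ, p.Prime → ∀ (k : Type) [Field k] [CharP k p]
    (Y : Scheme.{0}) (g : Y ⟶ Spec (.of k)), IsSeparated g → LocallyOfFiniteType g → QuasiCompact g →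
    ∀ hY : Scheme.IsRegular Y, topologicalKrullDim Y ≤ 4 →
    ∀ I : Y.IdealSheafData, (∀ y : Y, idealOrder I y ≤ ((n : ℕ) : ℕ∞)) →
      (∃ y : Y, idealOrder I y = ((n : ℕ) : ℕ∞) ∧ IsNearSpecialPt g hY I n y
        ∧ FaceFormCutClasses.IsDeepFacePt I n y) →
      ∃ t : CentreSeq Y, WeakResolution t (⟨I, [], n⟩ : MarkedIdeal Y)

/-- `SeqNSpecPower n` — POWER-FACE stratum: no near-special top point is deep, some has a power face `Lⁿ·M`
(infinite bad locus; bed: the `t·y^p`-umbrellas, CossartPiltant2019 Rem. 3.2).  [UNDECIDED · INSTRUMENTABLE.]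
(Sources: CossartPiltant2019 Rem. 3.2.) -/
def SeqNSpecPower (n : ℕ) : Prop :=
  ∀ p : ℕ, p.Prime → ∀ (k : Type) [Field k] [CharP k p]
    (Y : Scheme.{0}) (g : Y ⟶ Spec (.of k)), IsSeparated g → LocallyOfFiniteType g → QuasiCompact g →
    ∀ hY : Scheme.IsRegular Y, topologicalKrullDim Y ≤ 4 →
    ∀ I : Y.IdealSheafData, (∀ y : Y, idealOrder I y ≤ ((n : ℕ) : ℕ∞)) →
      (∀ y : Y, idealOrder I y = ((n : ℕ) : ℕ∞)
        → IsNearSpecialPt g hY I n y → ¬ FaceFormCutClasses.IsDeepFacePt I n y) →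
      (∃ y : Y, idealOrder I y = ((n : ℕ) : ℕ∞) ∧ IsNearSpecialPt g hY I n y ∧ IsPowerFacePt I n y) →
      ∃ t : CentreSeq Y, WeakResolution t (⟨I, [], n⟩ : MarkedIdeal Y)

/-- `SeqNSpecFin n` — FINITE-BAD-LOCUS stratum: near-special top points exist, none is deep, none has a power face
(so each has `Φ ≠ 0` with finitely many points of multiplicity `≥ n`: an IRRATIONAL one, or a rational VERY-NEAR
direction; bed: Giraud-type purely inseparable `(2,2)` points, `(3,3)` points with `Ψ_w = Z³ + bT⁶`).
[UNDECIDED · INSTRUMENTABLE.] (Sources: Giraud1975; CossartPiltant2008 Prop. 4.2.) -/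
def SeqNSpecFin (n : ℕ) : Prop :=
  ∀ p : ℕ, p.Prime → ∀ (k : Type) [Field k] [CharP k p]
    (Y : Scheme.{0}) (g : Y ⟶ Spec (.of k)), IsSeparated g → LocallyOfFiniteType g → QuasiCompact g →
    ∀ hY : Scheme.IsRegular Y, topologicalKrullDim Y ≤ 4 →
    ∀ I : Y.IdealSheafData, (∀ y : Y, idealOrder I y ≤ ((n : ℕ) : ℕ∞)) →
      (∃ y : Y, idealOrder I y = ((n : ℕ) : ℕ∞) ∧ IsNearSpecialPt g hY I n y) →
      (∀ y : Y, idealOrder I y = ((n : ℕ) : ℕ∞) → IsNearSpecialPt g hY I n y →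
        ¬ FaceFormCutClasses.IsDeepFacePt I n y ∧ ¬ IsPowerFacePt I n y) →
      ∃ t : CentreSeq Y, WeakResolution t (⟨I, [], n⟩ : MarkedIdeal Y)

/-- **`OneShotPortTwo n`** [COSTUME(M) · engine-free bookkeeping, = g9's `OneShotPort` with the class-2 exit form]: if
every top point of a dim-4 datum is of class ≥ 2 or a (class-2-form) EXIT point, `SeqDimFour 2 n` already yields a
weak resolution — blow up the finitely many isolated closed exit points (a weakly admissible `CentreSeq` prefix), off
the centres orders and classes are unchanged, over them every near point has `τ ≥ 2` hence class ≥ 2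
(`ClassGE … 2` holds with `2 ≤ τ`), `ord ≤ n` persists ([CoP1] 4.2 (a)); apply `SeqDimFour 2 n` and concatenate.
STATEMENT (port). (Sources: BierstoneGrigorievMilmanWlodarczyk2011 Def. 3.1.3; CossartPiltant2008 Prop. 4.2.) -/
def OneShotPortTwo (n : ℕ) : Prop :=
  SeqDimFour 2 n →
  ∀ p : ℕ, p.Prime → ∀ (k : Type) [Field k] [CharP k p]
    (Y : Scheme.{0}) (g : Y ⟶ Spec (.of k)), IsSeparated g → LocallyOfFiniteType g → QuasiCompact g →
    ∀ hY : Scheme.IsRegular Y, topologicalKrullDim Y ≤ 4 →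
    ∀ I : Y.IdealSheafData, (∀ y : Y, idealOrder I y ≤ ((n : ℕ) : ℕ∞)) →
      (∀ y : Y, idealOrder I y = ((n : ℕ) : ℕ∞) → ClassGE g hY I n 2 y ∨ IsNearExitPt I n y) →
      ∃ t : CentreSeq Y, WeakResolution t (⟨I, [], n⟩ : MarkedIdeal Y)

/-- `NGenRungAt n` — the near-generic rung at one marking.  [DECIDED-MOD-PORT.] -/
def NGenRungAt (n : ℕ) : Prop := SeqDimFour 2 n → SeqNGen n

/-- **`NearGenericRung`** — the NEAR-GENERIC half of `RungOne`.  [DECIDED-MOD-PORT(M): `nearGenericRung_of_engine`.]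
STATEMENT (decided piece). (Sources: CossartPiltant2008 Prop. 4.2.) -/
def NearGenericRung : Prop := E 2 → ∀ n : ℕ, 1 ≤ n → SeqNGen n

/-- **`NearSpecialRung`** — the NEAR-SPECIAL half of `RungOne` = THE LOCATED RESIDUAL of this node.
[UNDECIDED · IDEA-NEEDED · cofinal on the bed ⇒ score 0.]  STATEMENT (located residual). (Sources: CossartPiltant2019
Rem. 3.2; Giraud1975.) -/
def NearSpecialRung : Prop := E 2 → ∀ n : ℕ, 1 ≤ n → SeqNSpec n

end Summit.ResolutionOfSingularities.ResolutionOfSingularities.Theorems.VeryNearCutClasses
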